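import Mathlib
import Literature.Computability.Complexity.Rossman2008CliqueProofs
import Summits.PneNP.PneNP.Theorems.ConvexRankGatesConvexGateBlindSoftWindow

/-!
# PneNP / ConvexRankGates — `ConvexGateBlind`: minimal clique-non-negative weightings

Helpers (`--supports stmt-PneNP-10680`), COLUMN-SPACE line (prover seat 2, session 13). For the catch-probability
bound of `…NegCoverCatch.lean` a `k`-clique-non-negative edge weighting `w` (`w(E(Q)) = softWindow w Q ≥ 0` on
`k`-sets) is first replaced by a MINIMAL one below it: lowering the weight of an edge keeps every bad colouring bad
(the weight on the bichromatic edges only decreases), and one may lower until every edge of positive weight lies in a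
TIGHT `k`-set (`w(E(Q)) = 0`). In a minimal weighting a positive entry is at most `C(k,2) − 1` times the largest
negative entry of its tight set — so all entries are `O(k³/m)` times the total once the entry bound of
`…CliqueNonnegL1.lean` is plugged in.

* `softWindow_sub_ite` — lowering one edge by `a` lowers `w(E(Q))` by `a·𝟙[e ⊆ Q]`;
* `exists_lower_edge` — one greedy step; `exists_minimal_le` (stub `cliqueNonneg_minimal_reduction`) — a valid `v ≤ w`
  with every positive edge in a tight `k`-set (greedy over the edges; tight sets stay tight under further lowering);
* `le_of_tight` — in a tight `k`-set, `v(e) ≤ (C(k,2) − 1)·B` whenever `−v ≤ B` pointwise;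
* `bichSum_mono` — the weight carried by the edges of any graph `u` is monotone in the weighting.
[new; elementary]
-/

set_option linter.dupNamespace false

namespace Summit.PneNP.PneNP.Theorems

open Finset
open Summit.PneNP.PneNP.Cruxes.ConvexGateBlind.StrictRankConicCover (Edge)

noncomputable section

variable {m : ℕ}

/-- Lowering the weight of one edge `e` by `a` lowers `w(E(S))` by `a` if `e ⊆ S` and not at all otherwise. [folklore] -/
theorem softWindow_sub_ite (w : Edge m → ℝ) (e : Edge m) (a : ℝ) (S : Finset (Fin m)) :
    softWindow (fun f => w f - (if f = e then a else 0)) S = softWindow w S - (if edgeVerts e ⊆ S then a else 0) := by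
  classical
  unfold softWindow
  rw [Finset.sum_sub_distrib, Finset.sum_ite_eq' ((Finset.univ : Finset (Edge m)).filter (fun f => edgeVerts f ⊆ S)) e]
  simp only [Finset.mem_filter, Finset.mem_univ, true_and]

/-- `w(E(S))` is monotone in the weighting. [folklore] -/
theorem softWindow_mono {v w : Edge m → ℝ} (h : ∀ f, v f ≤ w f) (S : Finset (Fin m)) :
    softWindow v S ≤ softWindow w S :=
  Finset.sum_le_sum fun f _ => h f

/-- Every edge lies in some `k`-set (`2 ≤ k ≤ m`). [folklore] -/
theorem exists_powersetCard_superset_edge {k : ℕ} (hk : 2 ≤ k) (hkm : k ≤ m) (e : Edge m) :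
    (((Finset.univ : Finset (Fin m)).powersetCard k).filter (fun Q => edgeVerts e ⊆ Q)).Nonempty := by
  rw [← Finset.card_pos, card_filter_powersetCard_superset _ (by rw [card_edgeVerts]; exact hk), card_edgeVerts]
  exact Nat.choose_pos (by omega)

/-- **One greedy step.** Given a `k`-clique-non-negative `w` and an edge `e`, lowering `w(e)` by
`min (w(e)) (min_{Q ∋ e} w(E(Q)))` (when `w(e) > 0`) keeps validity, changes no other edge, and afterwards either
`w(e) ≤ 0` or `e` lies in a tight `k`-set. [new; elementary] -/
theorem exists_lower_edge {k : ℕ} (hk : 2 ≤ k) (hkm : k ≤ m) (w : Edge m → ℝ)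
    (hw : ∀ Q ∈ (Finset.univ : Finset (Fin m)).powersetCard k, 0 ≤ softWindow w Q) (e : Edge m) :
    ∃ w' : Edge m → ℝ, (∀ Q ∈ (Finset.univ : Finset (Fin m)).powersetCard k, 0 ≤ softWindow w' Q) ∧
      (∀ f, w' f ≤ w f) ∧ (∀ f, f ≠ e → w' f = w f) ∧
      (0 < w' e → ∃ Q ∈ (Finset.univ : Finset (Fin m)).powersetCard k, edgeVerts e ⊆ Q ∧ softWindow w' Q = 0) := by
  classical
  obtain ⟨Q₀, hQ₀, hmin⟩ := Finset.exists_min_image _ (softWindow w) (exists_powersetCard_superset_edge hk hkm e)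
  rw [Finset.mem_filter] at hQ₀
  set a : ℝ := min (max (w e) 0) (softWindow w Q₀) with ha
  have ha0 : 0 ≤ a := le_min (le_max_right _ _) (hw Q₀ hQ₀.1)
  refine ⟨fun f => w f - (if f = e then a else 0), ?_, ?_, ?_, ?_⟩
  · intro Q hQ
    rw [softWindow_sub_ite]
    by_cases heQ : edgeVerts e ⊆ Q
    · rw [if_pos heQ]
      have h1 : softWindow w Q₀ ≤ softWindow w Q := hmin Q (Finset.mem_filter.2 ⟨hQ, heQ⟩)
      have h2 : a ≤ softWindow w Q₀ := min_le_right _ _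
      linarith
    · rw [if_neg heQ, sub_zero]
      exact hw Q hQ
  · intro f
    show w f - (if f = e then a else 0) ≤ w f
    split_ifs <;> linarith
  · intro f hf
    show w f - (if f = e then a else 0) = w f
    rw [if_neg hf, sub_zero]
  · intro hpos
    have hpos' : 0 < w e - a := by simpa using hpos
    refine ⟨Q₀, hQ₀.1, hQ₀.2, ?_⟩
    rw [softWindow_sub_ite, if_pos hQ₀.2]
    -- `a < w e` forces `a = softWindow w Q₀`
    have hwe : max (w e) 0 = w e := max_eq_left (by linarith [min_le_left (max (w e) 0) (softWindow w Q₀), le_max_left (w e) 0])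
    have : a = softWindow w Q₀ := by
      rw [ha, hwe]
      rcases le_total (w e) (softWindow w Q₀) with h | h
      · exfalso
        rw [ha, hwe, min_eq_left h] at hpos'
        linarith
      · exact min_eq_right h
    rw [this, sub_self]

/-- **Minimal reduction.** Below every `k`-clique-non-negative weighting `w` (`2 ≤ k ≤ m`) there is a `k`-clique-non-negative
`v ≤ w` in which every edge of positive weight lies in a tight `k`-set (`v(E(Q)) = 0`). (Greedy over the edges:
lowering later edges only lowers clique sums, so a tight set stays tight and a non-positive edge stays non-positive.)
[new; elementary] -/
theorem exists_minimal_le {k : ℕ} (hk : 2 ≤ k) (hkm : k ≤ m) (w : Edge m → ℝ)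
    (hw : ∀ Q ∈ (Finset.univ : Finset (Fin m)).powersetCard k, 0 ≤ softWindow w Q) :
    ∃ v : Edge m → ℝ, (∀ Q ∈ (Finset.univ : Finset (Fin m)).powersetCard k, 0 ≤ softWindow v Q) ∧
      (∀ f, v f ≤ w f) ∧
      (∀ e, 0 < v e → ∃ Q ∈ (Finset.univ : Finset (Fin m)).powersetCard k, edgeVerts e ⊆ Q ∧ softWindow v Q = 0) := by
  classical
  suffices hS : ∀ (S : Finset (Edge m)) (w : Edge m → ℝ),
      (∀ Q ∈ (Finset.univ : Finset (Fin m)).powersetCard k, 0 ≤ softWindow w Q) →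
      ∃ v : Edge m → ℝ, (∀ Q ∈ (Finset.univ : Finset (Fin m)).powersetCard k, 0 ≤ softWindow v Q) ∧
        (∀ f, v f ≤ w f) ∧
        (∀ e ∈ S, 0 < v e → ∃ Q ∈ (Finset.univ : Finset (Fin m)).powersetCard k, edgeVerts e ⊆ Q ∧ softWindow v Q = 0) by
    obtain ⟨v, hv, hle, htight⟩ := hS Finset.univ w hw
    exact ⟨v, hv, hle, fun e he => htight e (Finset.mem_univ e) he⟩
  intro S
  induction S using Finset.induction_on with
  | empty => exact fun w hw => ⟨w, hw, fun f => le_rfl, fun e he => absurd he (Finset.notMem_empty e)⟩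
  | @insert e S heS ih =>
    intro w hw
    obtain ⟨w', hw', hle', -, htight'⟩ := exists_lower_edge hk hkm w hw e
    obtain ⟨v, hv, hle, htight⟩ := ih w' hw'
    refine ⟨v, hv, fun f => (hle f).trans (hle' f), ?_⟩
    intro f hf hpos
    rcases Finset.mem_insert.1 hf with rfl | hfS
    · obtain ⟨Q, hQ, hfQ, h0⟩ := htight' (lt_of_lt_of_le hpos (hle f))
      refine ⟨Q, hQ, hfQ, le_antisymm ?_ (hv Q hQ)⟩
      calc softWindow v Q ≤ softWindow w' Q := softWindow_mono hle Q
        _ = 0 := h0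
    · exact htight f hfS hpos

/-- **Minimal reduction** (registered form of `exists_minimal_le`). [new; elementary] -/
theorem cliqueNonneg_minimal_reduction : ∀ {m k : ℕ}, 2 ≤ k → k ≤ m → ∀ (w : Edge m → ℝ), (∀ Q ∈ (Finset.univ : Finset (Fin m)).powersetCard k, 0 ≤ softWindow w Q) → ∃ v : Edge m → ℝ, (∀ Q ∈ (Finset.univ : Finset (Fin m)).powersetCard k, 0 ≤ softWindow v Q) ∧ (∀ f, v f ≤ w f) ∧ (∀ e, 0 < v e → ∃ Q ∈ (Finset.univ : Finset (Fin m)).powersetCard k, edgeVerts e ⊆ Q ∧ softWindow v Q = 0) :=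
  fun hk hkm w hw => exists_minimal_le hk hkm w hw

/-- **Positive entries of a tight set.** If `v(E(Q)) = 0` on a `k`-set `Q ∋ e` and `−v ≤ B` pointwise, then
`v(e) ≤ (C(k,2) − 1)·B`: the positive weight of `e` is compensated by the other `C(k,2) − 1` edges of `Q`. [new; elementary] -/
theorem le_of_tight {k : ℕ} (v : Edge m → ℝ) {Q : Finset (Fin m)} (hQ : Q.card = k) (h0 : softWindow v Q = 0)
    {e : Edge m} (he : edgeVerts e ⊆ Q) {B : ℝ} (hB : ∀ f, -v f ≤ B) :
    v e ≤ ((k.choose 2 : ℕ) - 1 : ℝ) * B := by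
  classical
  set F : Finset (Edge m) := (Finset.univ : Finset (Edge m)).filter (fun f => edgeVerts f ⊆ Q) with hF
  have heF : e ∈ F := Finset.mem_filter.2 ⟨Finset.mem_univ _, he⟩
  have hcard : F.card = k.choose 2 := by
    rw [hF, ← hQ, ← Literature.Computability.Complexity.card_filter_cliqueVec Q]
    congr 1
    ext f
    simp only [Finset.mem_filter, Finset.mem_univ, true_and, cliqueVec_eq_true_iff_edgeVerts_subset]
  have hsum : v e + ∑ f ∈ F.erase e, v f = 0 := by
    rw [Finset.add_sum_erase F v heF]
    exact h0
  have hrest : -∑ f ∈ F.erase e, v f ≤ ((F.erase e).card : ℝ) * B := by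
    rw [← Finset.sum_neg_distrib]
    calc ∑ f ∈ F.erase e, -v f ≤ ∑ _f ∈ F.erase e, B := Finset.sum_le_sum fun f _ => hB f
      _ = ((F.erase e).card : ℝ) * B := by rw [Finset.sum_const, nsmul_eq_mul]
  rw [Finset.card_erase_of_mem heF, hcard, Nat.cast_sub (Nat.one_le_iff_ne_zero.2 ?_)] at hrest
  · push_cast at hrest
    linarith
  · rw [← hcard]
    exact Finset.card_ne_zero_of_mem heF

/-- **Monotonicity of the bichromatic (or any edge-set) weight.** If `v ≤ w` pointwise then the weight carried by
the edges of any graph `u` satisfies `v(u) ≤ w(u)`; so a colouring that is bad for `w` (`w(bich) < 0`) is bad for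
every `v ≤ w`. [folklore] -/
theorem bichSum_mono {v w : Edge m → ℝ} (h : ∀ f, v f ≤ w f) (u : Edge m → Bool) :
    ∑ e, (if u e = true then v e else 0) ≤ ∑ e, (if u e = true then w e else 0) :=
  Finset.sum_le_sum fun e _ => by split_ifs <;> [exact h e; exact le_rfl]

end

end Summit.PneNP.PneNP.Theorems
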